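import Summits.BirchSwinnertonDyer.Rank1Residual.Supersingular.KuriharaTwistRecordAssemblyLValues
import Summits.BirchSwinnertonDyer.Rank1Residual.Supersingular.KuriharaTwistRecordBallGeneric
import Summits.BirchSwinnertonDyer.Rank1Residual.Supersingular.KuriharaTwistDlogChar
import Summits.BirchSwinnertonDyer.Rank1Residual.Supersingular.RankOneRem13RecordShapesCount
import Summits.BirchSwinnertonDyer.Rank1Residual.Additive.X4ThreeKuriharaCertKernel
import Summits.BirchSwinnertonDyer.Rank1Residual.SecondDescent.CanaryTargetsClassCertificates
import HarnessLib

/-!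
# N4 (X6 ∧ `r_an = 0`, `p ≥ 5`, `p ∤ ∏c`) PER-PAIR OFFER SHAPE: `BSD(E,p)` from the literal integer equation,
# a LANDED twist record + rounding certificate, KERNEL certificates for everything decidable (minimality,
# class X6, the Kolyvagin level from point counts, cyclicity, the discrete logarithms), and EXACTLY the binders
# {Kim Thm 1.9 (6), period, GZK, modularity, the newform, `r_an = 0`, `p ∤ ∏c`, the `L`-value enclosure}

Cell `b2b-bsdres`, supersingular family, prover A = unit `b2b-bsdres-x10b` (gen 12), N4 class lead.  Topic
file; namespace `Summit.BirchSwinnertonDyer.Rank1Residual.Supersingular`.  THEOREMS ONLY (compositions by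
name); no named fact, no definition, nothing asserted about any curve, nothing booked; X6 stays
CONSTRUCTION-SHAPED (mark of RESIDUAL-MAP §I N4 unchanged).

HONEST FRAMING (run/shared/lean/b2b/bsd-rank1-residual/, verbatim in every file): the goal of the
cell is to DELETE the COMBINATION-SHAPED residual classes of the Birch–Swinnerton-Dyer formula for
ALL analytic-rank `≤ 1` elliptic curves over `ℚ` — "full BSD formula for every rank `≤ 1` curve in
class `C`" assembled STRICTLY from published theorems — so that the rank-`≤ 1` remainder becomes
exactly the CONSTRUCTION-SHAPED classes, which are TYPED (missing-input `Prop`s), NOT attempted.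
This is not "finishing BSD".

## What this file proves (the A-side companion of B's `RankOneRem13RecordShapes{,Count}`)

* `classX6_of_intModel` — `ClassX6 W p` (`p ≥ 5`) read off an integer model: `p ∤ Δ`, `#Ẽ(𝔽_p) = n` with
  `p ∣ p + 1 − n` (good supersingular) and `gcd(Δ, c₄) = 1` (semistable; cc-eng-4's
  `semistable_of_intModel_of_gcd_eq_one`).
* **`X6RankZero.bsdp_of_ainvs_of_certifiedL_of_LValueBall`** — the RECORD SHAPE.  Input per pair, all
  DECIDED IN THE KERNEL at instantiation: the literal `[a₁,a₂,a₃,a₄,a₆]` with x11c's bounded Kraus/Silverman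
  minimality, `p ∤ Δ`, `countPoints … p = n_p`, `p ∣ p+1−n_p`, `gcd(Δ,c₄) = 1`; the level `n = ℓ₁ℓ₂` of a
  LANDED `CertifiedL` row `r` with two Kolyvagin primes READ OFF POINT COUNTS (`ℓᵢ ∤ Δ`, `ℓᵢ ≡ 1 (p)`,
  `countPoints … ℓᵢ = nᵢ`, `p ∣ nᵢ`, `p² ∤ nᵢ` — n1011-p03's `isKolyvaginPrime_of_intModel_of_card`,
  `forall_card_torsion_le_of_pair`); a rounding certificate `c` passing `validHasse` and matching `r`; the
  discrete logarithms `ψᵢ : (ℤ/ℓᵢ)ˣ ↠ ℤ/p` (surjective; per pair `dlogChar ℓᵢ p ηᵢ` of the recorded roots,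
  `KuriharaTwistDlogChar`).  Remaining hypotheses = EXACTLY: the named facts `hKim` (Kim 2026 Thm 1.9 (6)),
  `hϖ` (period), `hGZK`, `hmod`; the newform `f` of `E` (`hf`); the data binders `r_an = 0`, `p ∤ ∏c_ℓ`
  (Cremona `allbsd`); and **`hballL`** — the engine's enclosure of
  `D'·c_∞·re(Π_{ℓ∣n}(a_ℓ−2)·L(E,1) + Σ_{j≠0} e_p(−jk)·τ(χ_j)·L_j(1))/(p·Ω⁺_f)` (implementation 3c/3d;
  `KuriharaTwistRecordAssemblyLValues`).  Conclusion `BSDp W p`.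
Per pair; NOT a class theorem; nothing booked (records built on this shape are OFFERS for referee A).

References: `KuriharaTwistRecordAssemblyLValues.lean`, `KuriharaTwistDlogChar.lean` (gen 12);
`RankOneRem13RecordShapes{,Count}.lean` (additive-p3 gen 20); `Additive/X4ThreeKuriharaCertKernel.lean`
(n1011-p03); `SecondDescent/CanaryTargetsClassCertificates.lean` (cc-eng-4); C.-H. Kim, Amer. J. Math. 148
(2026) Thm. 1.9 (6) [Kim2022StructureSelmer]; [SilvermanAEC2009] VII.1, VII.5, VIII.8; [Kraus1989];
[IrelandRosen1990] Prop. 5.1.2; [MazurTateTeitelbaum1986Invent] §I.8; [CremonaAlgorithms1997] §2.8.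
-/

set_option autoImplicit false

noncomputable section

open scoped Classical MatrixGroups ModularForm

open CongruenceSubgroup WeierstrassCurve Literature.NumberTheory.EllipticCurves
  Literature.NumberTheory.EllipticCurves.ModularForms
  Literature.NumberTheory.EllipticCurves.Rank1Residual
  Literature.NumberTheory.EllipticCurves.Rank1Residual.Typed
  Literature.NumberTheory.EllipticCurves.Rank1Residual.X11RankOneCertificates
  Summit.BirchSwinnertonDyer.BirchSwinnertonDyer.Rank1Residual.IntModel
  Summit.BirchSwinnertonDyer.BirchSwinnertonDyer.Rank1Residual.X11RankOne
  Summit.BirchSwinnertonDyer.Rank1Residual.X11b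
  Summit.BirchSwinnertonDyer.Rank1Residual.Supersingular.KuriharaTwist

namespace Summit.BirchSwinnertonDyer.Rank1Residual.Supersingular

/-- **`ClassX6 W p` (`p ≥ 5`) read off an integer model**: `p ∤ Δ(E₀)` and `#(E₀ mod p)(𝔽_p) = n` with
`p ∣ p + 1 − n` (good supersingular at `p`), and `gcd(Δ(E₀), c₄(E₀)) = 1` (semistable).  The `p ≥ 5`
companion of cc-eng-4's `classX6_three_of_intModel`. [cite: SilvermanAEC2009, VII.5 Prop. 5.1(a) and (b)] -/
theorem classX6_of_intModel {W : WeierstrassCurve ℚ} [W.IsElliptic] [W.IsGloballyMinimal]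
    (p : ℕ) [Fact p.Prime] (hp : 5 ≤ p) {E₀ : WeierstrassCurve ℤ} (hI : integralModelInt W = E₀)
    (hpΔ : ¬ (p : ℤ) ∣ E₀.Δ) {n : ℕ} (hn : Nat.card ((E₀.map (Int.castRingHom (ZMod p))).toAffine.Point) = n)
    (hap : (p : ℤ) ∣ (p : ℤ) + 1 - n) (hgcd : Int.gcd E₀.Δ E₀.c₄ = 1) : ClassX6 W p :=
  ⟨goodSS_of_intModel p hI hpΔ hn hap, SecondDescent.semistable_of_intModel_of_gcd_eq_one hI hgcd, Or.inl hp⟩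

/-- The product `Π_{ℓ ∣ ℓ₁ℓ₂} (a_ℓ(E) − 2)` over the two level primes, from the two point counts
(`a_ℓ = ℓ + 1 − #Ẽ(𝔽_ℓ)`), as the cast of an explicit integer. [folklore] -/
theorem prod_primeFactors_frobeniusTrace_sub_two_eq {W : WeierstrassCurve ℚ} [W.IsElliptic] [W.IsGloballyMinimal]
    {E₀ : WeierstrassCurve ℤ} (hI : integralModelInt W = E₀) {ℓ₁ ℓ₂ : ℕ} (h₁ : ℓ₁.Prime) (h₂ : ℓ₂.Prime)
    (hne : ℓ₁ ≠ ℓ₂) {n₁ n₂ : ℕ} (hc₁ : Nat.card ((E₀.map (Int.castRingHom (ZMod ℓ₁))).toAffine.Point) = n₁)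
    (hc₂ : Nat.card ((E₀.map (Int.castRingHom (ZMod ℓ₂))).toAffine.Point) = n₂) {A : ℤ}
    (hA : A = ((ℓ₁ : ℤ) + 1 - n₁ - 2) * ((ℓ₂ : ℤ) + 1 - n₂ - 2)) :
    (∏ ℓ ∈ (ℓ₁ * ℓ₂).primeFactors, ((W.frobeniusTrace ℓ : ℂ) - 2)) = (A : ℂ) := by
  rw [Nat.primeFactors_mul h₁.ne_zero h₂.ne_zero, h₁.primeFactors, h₂.primeFactors,
    show ({ℓ₁} ∪ {ℓ₂} : Finset ℕ) = {ℓ₁, ℓ₂} from rfl, Finset.prod_pair hne, frobeniusTrace_eq hI hc₁,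
    frobeniusTrace_eq hI hc₂, hA]
  push_cast
  ring

/-- **N4 RECORD SHAPE — `BSD(E,p)` on X6 ∧ `r_an = 0` ∧ `p ≥ 5` ∧ `p ∤ ∏c` from the literal equation, a
landed twist record + rounding certificate, kernel certificates, and the `L`-value enclosure.**  `W` is the
literal curve `⟨a₁,…,a₆⟩` with x11c's bounded Kraus/Silverman minimality (`decide`d); decidable inputs: `p ∤ Δ`,
`countPoints … p = n_p`, `p ∣ p+1−n_p`, `gcd(Δ,c₄) = 1` (class X6, `classX6_of_intModel`); the level
`r.n = ℓ₁ℓ₂` of the landed `CertifiedL` row `r` with `ℓᵢ ∤ Δ`, `ℓᵢ ≡ 1 (p)`, `countPoints … ℓᵢ = nᵢ`,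
`p ∣ nᵢ`, `p² ∤ nᵢ` (Kolyvagin + cyclic, n1011-p03's certificates) and `A = (ℓ₁+1−n₁−2)(ℓ₂+1−n₂−2)`
(`= Π(a_ℓ − 2)`); a rounding certificate `c` passing `validHasse` and matching `r`; surjective discrete
logarithms `ψ₁, ψ₂` (per pair `dlogChar ℓᵢ p ηᵢ`).  REMAINING HYPOTHESES = EXACTLY the named facts `hKim`,
`hϖ`, `hGZK`, `hmod`; the newform `f` (`hf`); the data binders `r_an = 0`, `p ∤ ∏c`; and `hballL`, the
engine's enclosure of `D'·c_∞·re(A·L(E,1) + Σ_{j≠0} e_p(−jk)·τ(χ_j)·L_j(1))/(p·Ω⁺_f)`.  Per pair; NOT a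
class theorem; nothing booked. [cite: Kim2022StructureSelmer, Thm. 1.9 (6) (PDF p. 8), Cor. 1.6]
[cite: MazurTateTeitelbaum1986Invent, §I.8 (8.6)] [cite: CremonaAlgorithms1997, §2.8 (2.8.8) (PDF p. 26)]
[cite: SilvermanAEC2009, VII.5 Prop. 5.1(a) and (b)] [cite: IrelandRosen1990, Prop. 5.1.2 and §8.1] -/
theorem X6RankZero.bsdp_of_ainvs_of_certifiedL_of_LValueBall
    (hKim : Kim2022_rankZero_padicValRat_sha_of_kuriharaNumber_ne_zero)
    (hϖ : realPeriodRat_eq_unit_mul_plusPeriod)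
    (hGZK : rank_eq_analyticRank_of_analyticRank_le_one) (hmod : hasEntireLFunction_rat)
    (a1 a2 a3 a4 a6 : ℤ)
    (hB : (discOf [a1, a2, a3, a4, a6]).natAbs < 512 ^ 12)
    (hmin : ∀ q < 512, q < 2 ∨ ¬ q ^ 12 ∣ (discOf [a1, a2, a3, a4, a6]).natAbs ∨
      ¬ q ^ 4 ∣ (c4Of [a1, a2, a3, a4, a6]).natAbs ∨
      (q = 2 ∧ ¬ (2 : ℤ) ^ 8 ∣ c4Of [a1, a2, a3, a4, a6] ∧ (2 : ℤ) ^ 7 ∣ c6Of [a1, a2, a3, a4, a6]) ∨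
      (q = 2 ∧ ¬ (2 : ℤ) ^ 24 ∣ discOf [a1, a2, a3, a4, a6] ∧ (512 : ℤ) ∣ c6Of [a1, a2, a3, a4, a6] ∧
        (4 : ℤ) ∣ c6Of [a1, a2, a3, a4, a6] / 512 - 3) ∨
      (q = 3 ∧ (3 : ℤ) ^ 8 ∣ c6Of [a1, a2, a3, a4, a6] ∧ ¬ (3 : ℤ) ^ 9 ∣ c6Of [a1, a2, a3, a4, a6]))
    -- the landed twist record and its rounding certificate
    {rs : List TwistRecord} (hrs : CertifiedL rs) {r : TwistRecord} (hr : r ∈ rs) [Fact r.p.Prime] [NeZero r.n]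
    (hνp : r.primes.length < r.p) (hν : r.n.primeFactors.card = r.primes.length)
    {c : RoundingCert} (hcv : c.validHasse = true)
    (hcp : c.p = r.p) (hcn : c.n = r.n) (hcden : c.den = r.den) (hcbins : c.bins = r.bins) (hD' : 0 < c.dstar)
    (hp : 5 ≤ r.p)
    -- class X6 at `p` from the model
    (hpΔ : ¬ (r.p : ℤ) ∣ discOf [a1, a2, a3, a4, a6]) {np : ℕ}
    (hcnt : countPoints [a1, a2, a3, a4, a6] r.p = np) (hap : (r.p : ℤ) ∣ (r.p : ℤ) + 1 - np)
    (hgcd : Int.gcd (discOf [a1, a2, a3, a4, a6]) (c4Of [a1, a2, a3, a4, a6]) = 1)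
    -- the Kolyvagin level `r.n = ℓ₁ · ℓ₂` from point counts
    (ℓ₁ ℓ₂ : ℕ) [Fact ℓ₁.Prime] [Fact ℓ₂.Prime] (hrn : r.n = ℓ₁ * ℓ₂) (hne : ℓ₁ ≠ ℓ₂)
    (hℓ₁p : ℓ₁ ≠ r.p) (hℓ₂p : ℓ₂ ≠ r.p) (hℓ₁2 : ℓ₁ ≠ 2) (hℓ₂2 : ℓ₂ ≠ 2)
    (hℓ₁Δ : ¬ (ℓ₁ : ℤ) ∣ discOf [a1, a2, a3, a4, a6]) (hℓ₂Δ : ¬ (ℓ₂ : ℤ) ∣ discOf [a1, a2, a3, a4, a6])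
    (h1₁ : ℓ₁ ≡ 1 [MOD r.p ^ 1]) (h1₂ : ℓ₂ ≡ 1 [MOD r.p ^ 1]) {n₁ n₂ : ℕ}
    (hc₁ : countPoints [a1, a2, a3, a4, a6] ℓ₁ = n₁) (hc₂ : countPoints [a1, a2, a3, a4, a6] ℓ₂ = n₂)
    (hd₁ : r.p ^ 1 ∣ n₁) (hd₂ : r.p ^ 1 ∣ n₂) (hsq₁ : ¬ r.p ^ 2 ∣ n₁) (hsq₂ : ¬ r.p ^ 2 ∣ n₂)
    {A : ℤ} (hA : A = ((ℓ₁ : ℤ) + 1 - n₁ - 2) * ((ℓ₂ : ℤ) + 1 - n₂ - 2))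
    -- the discrete logarithms
    (ψ₁ : (ZMod ℓ₁)ˣ →* Multiplicative (ZMod (r.p ^ 1))) (hψ₁ : Function.Surjective ψ₁)
    (ψ₂ : (ZMod ℓ₂)ˣ →* Multiplicative (ZMod (r.p ^ 1))) (hψ₂ : Function.Surjective ψ₂)
    -- data binders
    (hr0 : (⟨a1, a2, a3, a4, a6⟩ : WeierstrassCurve ℚ).analyticRank = 0)
    (htam : ¬ r.p ∣ (⟨a1, a2, a3, a4, a6⟩ : WeierstrassCurve ℚ).tamagawaProduct)
    {N : ℕ} [NeZero N] (f : CuspForm (Gamma0 N) 2) (hf : IsNewformOf (⟨a1, a2, a3, a4, a6⟩ : WeierstrassCurve ℚ) f)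
    -- the engine's enclosure claim, through twisted L-values
    (hballL : ∀ (L : ZMod (r.p ^ 1) → ℂ → ℂ), (∀ j, j ≠ 0 → Differentiable ℂ (L j)) →
      (∀ j, j ≠ 0 → ∀ s : ℂ, 2 < s.re →
        L j s = twistedLSeries f (binChar r.n (pairLogs ℓ₁ ℓ₂ ψ₁ ψ₂) j)⁻¹ s) →
      ∀ k < r.p, ∃ mid rad : ℝ, rad ≤ (c.radNum : ℝ) / 10 ^ c.radExp ∧
        |mid - ((c.binsStar.getD k 0 : ℤ) : ℝ)| ≤ (c.marNum : ℝ) / 10 ^ c.marExp ∧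
        |(c.dstar : ℝ) * ((r.components : ℝ) *
          (((A : ℂ) * (⟨a1, a2, a3, a4, a6⟩ : WeierstrassCurve ℚ).entireLFunction 1 +
            ∑ j ∈ (Finset.univ : Finset (ZMod (r.p ^ 1))).erase 0,
              ZMod.stdAddChar (-(j * (k : ZMod (r.p ^ 1)))) *
                (gaussSum (binChar r.n (pairLogs ℓ₁ ℓ₂ ψ₁ ψ₂) j) (ZMod.stdAddChar (N := r.n)) * L j 1)).re /
            ((r.p ^ 1 : ℕ) * plusPeriod f))) - mid| ≤ rad) :
    BSDp (⟨a1, a2, a3, a4, a6⟩ : WeierstrassCurve ℚ) r.p := by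
  have h0 : discOf [a1, a2, a3, a4, a6] ≠ 0 := fun h ↦ hpΔ (by rw [h]; exact dvd_zero _)
  obtain ⟨_, _, hI⟩ := integralModelInt_ainvs_of_krausCriterion_bounded a1 a2 a3 a4 a6 h0 hB hmin
  have hp2 : r.p ≠ 2 := by omega
  have hN₁ := natCard_point_eq_of_countPoints a1 a2 a3 a4 a6 ℓ₁ hℓ₁2 hℓ₁Δ hc₁
  have hN₂ := natCard_point_eq_of_countPoints a1 a2 a3 a4 a6 ℓ₂ hℓ₂2 hℓ₂Δ hc₂
  -- class X6 at `p`
  have hX : ClassX6 (⟨a1, a2, a3, a4, a6⟩ : WeierstrassCurve ℚ) r.p :=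
    classX6_of_intModel r.p hp hI (by rw [intCurve_Δ]; exact hpΔ)
      (natCard_point_eq_of_countPoints a1 a2 a3 a4 a6 r.p hp2 hpΔ hcnt) hap
      (by rw [intCurve_Δ, intCurve_c₄]; exact hgcd)
  -- the Kolyvagin level and cyclicity from the two point counts
  have hK₁ : Kato.IsKolyvaginPrime (⟨a1, a2, a3, a4, a6⟩ : WeierstrassCurve ℚ) r.p 1 ℓ₁ :=
    Additive.isKolyvaginPrime_of_intModel_of_card hI r.p 1 ℓ₁ hℓ₁p (by rw [intCurve_Δ]; exact hℓ₁Δ) h1₁ hN₁ hd₁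
  have hK₂ : Kato.IsKolyvaginPrime (⟨a1, a2, a3, a4, a6⟩ : WeierstrassCurve ℚ) r.p 1 ℓ₂ :=
    Additive.isKolyvaginPrime_of_intModel_of_card hI r.p 1 ℓ₂ hℓ₂p (by rw [intCurve_Δ]; exact hℓ₂Δ) h1₂ hN₂ hd₂
  have hn : Kato.IsKolyvaginProduct (⟨a1, a2, a3, a4, a6⟩ : WeierstrassCurve ℚ) r.p 1 r.n := by
    rw [hrn]; exact Additive.isKolyvaginProduct_mul hK₁ hK₂ hne
  have hcyc : ∀ (ℓ : ℕ) [Fact ℓ.Prime], ℓ ∣ r.n →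
      Nat.card {P : ((WeierstrassCurve.integralModelInt (⟨a1, a2, a3, a4, a6⟩ : WeierstrassCurve ℚ)).map
          (Int.castRingHom (ZMod ℓ))).toAffine.Point // r.p • P = 0} ≤ r.p := by
    rw [hrn]
    exact Additive.forall_card_torsion_le_of_pair hI r.p ℓ₁ ℓ₂ hN₁ hN₂ hsq₁ hsq₂
  -- the discrete logarithms
  have hψ : ∀ ℓ ∈ r.n.primeFactors, Function.Surjective (pairLogs ℓ₁ ℓ₂ ψ₁ ψ₂ ℓ) := by
    rw [hrn]
    exact surjective_pairLogs_of_mem_primeFactors ψ₁ ψ₂ Fact.out Fact.out hne hψ₁ hψ₂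
  -- the certificate row as a one-element `RoundingCertifiedHasse` list
  have hcs : RoundingCertifiedHasse [c] :=
    (RoundingCertifiedHasse.cons_iff c []).2 ⟨hcv, RoundingCertifiedHasse.nil⟩
  -- `A = Π_{ℓ ∣ n} (a_ℓ − 2)`
  have hprod : (∏ ℓ ∈ r.n.primeFactors,
      (((⟨a1, a2, a3, a4, a6⟩ : WeierstrassCurve ℚ).frobeniusTrace ℓ : ℂ) - 2)) = (A : ℂ) := by
    rw [hrn]; exact prod_primeFactors_frobeniusTrace_sub_two_eq hI Fact.out Fact.out hne hN₁ hN₂ hA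
  refine X6.bsdp_rankZero_of_certifiedL_of_LValueBall _ hKim hϖ hGZK hmod hrs hr hνp hν hcs
    (List.mem_singleton_self c) hcp hcn hcden hcbins hD' hp hX hr0 htam f hf
    (coprime_level_of_isKolyvaginProduct hf hn) hn hcyc (pairLogs ℓ₁ ℓ₂ ψ₁ ψ₂) hψ ?_
  intro L hL hL' k hk
  obtain ⟨mid, rad, h1, h2, h3⟩ := hballL L hL hL' k hk
  refine ⟨mid, rad, h1, h2, ?_⟩
  rw [hprod]
  exact h3

end Summit.BirchSwinnertonDyer.Rank1Residual.Supersingular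

end
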